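import Summits.CriticalPhenomena.PercolationContinuityZ3.Theorems.Transplant.SkelConcRealised
import Summits.CriticalPhenomena.PercolationContinuityZ3.Theorems.Transplant.SkelPhiConcSchedule
import HarnessLib

/-!
# D″ node, STRUCTURE-FREE layer L6′ (C) part 1: REALISED anchor configurations and the (C) habitat radii at a chosen edge, for the φ-level
# cell geometry of record `Skelφ.cellGeomSG G φ P w₀ Λ` over the two-unit cells and p2-g7's schedule `Skelφ.concRadii2S P gap gap' E₀ L'`
# — the re-cut of `SkelConcRealised` §2–§3 (p5 gen 4) per DPRIME-SCOPE §2 L6′ (C) / L7′ and p3 addendum K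

builds on p205010 (kernel theorem, internal audit signed; external expert review pending) — nothing in this file uses p205010.
Lane `prim-bschramm`, seat `prim-bschramm-p5` (gen 6; (C) column, DPRIME K.4), helper file (`--supports stmt-CriticalPhenomena-4575`).  NEW FILE.
Source `SkelConcRealised`: its §1 (`Skel.realised_of_choice`, `Skel.l1_tgt_le_nQ`, `Skel.nQ_tgt_eq_nS_src_succ` — for ANY unit-increment scheme
`S : KSchA V ℕ`) is Φ-free and IMPORTED (K2.5); §2–§3 are re-typed here by the dictionary `Φ ↦ (G, φ)`, `C : PCells ↦ P : PCells2`,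
`cellGeomSG Φ C t Λ ↦ Skelφ.cellGeomSG G φ P t Λ` (p2-g7 `SkelPhiCellsConcG`), `Skel.concRadiiS C ↦ Skelφ.concRadii2S P` (p2-g7 `SkelPhiConcSchedule`),
`WFS ↦ WFS2`, `runGeomSG/anchGeomSG/sepGeomSG Φ C t ↦ Skelφ.runGeomSG/anchGeomSG/sepGeomSG P t … (hstep)`; the one dictionary hypothesis is
`hstep : Steps G φ` (through `sepGeomSG`), class (2) of K.3; `20 · C.r ≤ gap ↦ 20 · P.rmax ≤ gap`.
* `cellGeomSG_anchor`, `cellGeomSG_a₀` (`rfl`), **`realised_of_choice_SG`**, **`tgt_add_stepVec_ne_zero`** (valid histories), **`tgt_add_stepVec_ne_zero_of_run`**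
  (produced histories; `hstep`), and **`reach_radii_concSG`**: at a chosen edge `e = (v → x)`, `α = aOf₁`, `β = aOf₂`, onward `du`, with `E := Erad (nQ α x)`:
  `rQ α x = E`, `rB α v δ = E`, `ρ β x du ℓ = E − 2`, `rE β x du = Frad (nQ α x + 1) − 1`, `rM β (x+du) = Frad (nQ α x + 1) − L'`, `nQ α x = nS α v + 1`.
[cite: KozmaNitzan2024, §4 pp. 25–27 (the exploration process), p. 31 (the corridor step)]
-/

noncomputable section

open scoped Classical

namespace Summit.CriticalPhenomena.PercolationContinuityZ3.Theorems

namespace Transplant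

namespace Skelφ

open Literature.Probability.Percolation Literature.Probability.LatticeModels SimpleGraph GadgetSystem Contour KNCells
open Literature.Probability.Percolation.KozmaNitzan.Cells (stepVec_apply_fst stepVec_apply_oth)
open BoxProdZ2 (Realised ConcRadiiG nQ nS gen0 Erad Frad gen0_stepVec gen0_stepVec_add_stepVec)
open Skel (realised_of_choice l1_tgt_le_nQ nQ_tgt_eq_nS_src_succ)

variable {V : Type} [DecidableEq V] {G : SimpleGraph V} [G.LocallyFinite] {φ : V → Site 2}

/-! ## §1 The cell geometry of record `Skelφ.cellGeomSG` -/

section SG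

variable (G φ) (P : PCells2) (t : V) (Λ : ConcRadiiG) (q : unitInterval) (δc : ℝ)

/-- The re-centring rule of `cellGeomSG` is `a ↦ a + 1`. [folklore] -/
theorem cellGeomSG_anchor : ∀ a v Q, (⟨cellGeomSG G φ P t Λ, q, δc⟩ : KSchA V ℕ).Γ.anchor a v Q = a + 1 := fun _ _ _ => rfl

/-- The root anchor of `cellGeomSG` is `0`. [folklore] -/
theorem cellGeomSG_a₀ : (⟨cellGeomSG G φ P t Λ, q, δc⟩ : KSchA V ℕ).Γ.a₀ = 0 := rfl

variable {G φ P t Λ q δc}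

/-- **The anchors of a chosen edge of the scheme of record are realised.** [folklore] -/
theorem realised_of_choice_SG [Countable V] (h : ProbeHistory V) {e : Site 2 × MDir}
    (hc : ((⟨cellGeomSG G φ P t Λ, q, δc⟩ : KSchA V ℕ).astOf₂ G h).st.choice = some e) :
    Realised ((⟨cellGeomSG G φ P t Λ, q, δc⟩ : KSchA V ℕ).aOf₁ G h e) ((⟨cellGeomSG G φ P t Λ, q, δc⟩ : KSchA V ℕ).aOf₂ G h e) (tgt e) :=
  realised_of_choice (cellGeomSG_anchor G φ P t Λ q δc) (cellGeomSG_a₀ G φ P t Λ q δc) h hc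

/-- **Onward targets are never the root cell** (root in base position `φ t = 0`): after a valid history the root is explored, so the column of
the root cell `x = 0` is not onward. [cite: KozmaNitzan2024, §4 p. 27 ((29))] -/
theorem tgt_add_stepVec_ne_zero [Countable V] (hφ : φ t = 0) {h : ProbeHistory V} {e : Site 2 × MDir}
    (hV : (⟨cellGeomSG G φ P t Λ, q, δc⟩ : KSchA V ℕ).Valid₂ G h e) {du : MDir}
    (hdu : du ∈ (⟨cellGeomSG G φ P t Λ, q, δc⟩ : KSchA V ℕ).onward G h (tgt e)) : tgt e + stepVec du ≠ 0 := by
  intro h0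
  have hroot := hV.root_mem
  have hon := (Finset.mem_filter.1 hdu).2 _ hroot
  apply hon
  show φ t = P.cen (tgt e + stepVec du)
  rw [h0, PCells2.cen_zero, hφ]

/-- The same for every history PRODUCED by the scheme (`hst₂`), from the run invariant's `Q_0 ⊆ Vx` and `root ∈ Q_0` (`SepGeom.root_mem`
under `WFS2` and `φ t = 0`, (ι) steps) — no validity needed. [folklore] -/
theorem tgt_add_stepVec_ne_zero_of_run [Countable V] (hstep : Steps G φ) (hΛ : WFS2 P Λ) (hφ : φ t = 0) (ω : BondConfig V) (n : ℕ)
    (x : Site 2) {du : MDir} (hdu : du ∈ (⟨cellGeomSG G φ P t Λ, q, δc⟩ : KSchA V ℕ).onward G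
      ((⟨cellGeomSG G φ P t Λ, q, δc⟩ : KSchA V ℕ).hst₂ G ω n) x) : x + stepVec du ≠ 0 := by
  intro h0
  have hI := KSchA.runInv₂ (S := (⟨cellGeomSG G φ P t Λ, q, δc⟩ : KSchA V ℕ)) (G := G) (runGeomSG P t) (anchGeomSG P t) ω n
  have hroot : t ∈ (⟨cellGeomSG G φ P t Λ, q, δc⟩ : KSchA V ℕ).Vx G ((⟨cellGeomSG G φ P t Λ, q, δc⟩ : KSchA V ℕ).hst₂ G ω n) :=
    hI.Q0_sub (sepGeomSG P t hΛ hφ hstep).root_mem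
  have hon := (Finset.mem_filter.1 hdu).2 _ hroot
  apply hon
  show φ t = P.cen (x + stepVec du)
  rw [h0, PCells2.cen_zero, hφ]

end SG

/-! ## §2 The (C) habitat radii at a chosen edge, over the two-unit schedule `Skelφ.concRadii2S` -/

section ReachRadii

variable {P : PCells2} {t : V} {gap gap' : ℕ → ℕ} {E₀ L' : ℕ} {q : unitInterval} {δc : ℝ}

/-- **The (C) habitat radii at a chosen edge of the scheme of record** over `Λ = Skelφ.concRadii2S P gap gap' E₀ L'`: at `e = (v → x)` with
`α = aOf₁`, `β = aOf₂` and an onward `du`, with `E := Erad (nQ α x)`: cube radius `rQ α x = E` (max inactive, `20 · rmax ≤ gap`, `1 ≤ E₀`),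
between box `rB α v δ = E`, corridor profile `ρ β x du ℓ = E − 2` (all rows), far box `rE β x du = Frad (nQ α x + 1) − 1`, arrival cube
`rM β (x+du) = Frad (nQ α x + 1) − L'`, and `nQ α x = nS α v + 1`. [this work] -/
theorem reach_radii_concSG [Countable V] (hgap : ∀ n, 20 * P.rmax ≤ gap n) (hE₀ : 1 ≤ E₀) (hφ : φ t = 0)
    {h : ProbeHistory V} {e : Site 2 × MDir}
    (hc : ((⟨cellGeomSG G φ P t (concRadii2S P gap gap' E₀ L'), q, δc⟩ : KSchA V ℕ).astOf₂ G h).st.choice = some e)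
    (hV : (⟨cellGeomSG G φ P t (concRadii2S P gap gap' E₀ L'), q, δc⟩ : KSchA V ℕ).Valid₂ G h e) {du : MDir}
    (hdu : du ∈ (⟨cellGeomSG G φ P t (concRadii2S P gap gap' E₀ L'), q, δc⟩ : KSchA V ℕ).onward G h (tgt e)) :
    let α := (⟨cellGeomSG G φ P t (concRadii2S P gap gap' E₀ L'), q, δc⟩ : KSchA V ℕ).aOf₁ G h e
    let β := (⟨cellGeomSG G φ P t (concRadii2S P gap gap' E₀ L'), q, δc⟩ : KSchA V ℕ).aOf₂ G h e
    (concRadii2S P gap gap' E₀ L').rQ α (tgt e) = Erad gap gap' E₀ (nQ α (tgt e)) ∧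
    (concRadii2S P gap gap' E₀ L').rB α e.1 e.2 = Erad gap gap' E₀ (nQ α (tgt e)) ∧
    (∀ ℓ, (concRadii2S P gap gap' E₀ L').ρ β (tgt e) du ℓ = Erad gap gap' E₀ (nQ α (tgt e)) - 2) ∧
    (concRadii2S P gap gap' E₀ L').rE β (tgt e) du = Frad gap gap' E₀ (nQ α (tgt e) + 1) - 1 ∧
    (concRadii2S P gap gap' E₀ L').rM β (tgt e + stepVec du) = Frad gap gap' E₀ (nQ α (tgt e) + 1) - L' ∧
    nQ α (tgt e) = nS α e.1 + 1 := by
  intro α β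
  have hreal : Realised α β (tgt e) := realised_of_choice_SG h hc
  have hy : tgt e + stepVec du ≠ 0 := tgt_add_stepVec_ne_zero hφ hV hdu
  obtain ⟨h1, h2, h3⟩ := hreal.sched_hyps hy
  refine ⟨?_, rfl, fun ℓ => ?_, ?_, ?_, ?_⟩
  · exact concRadii2S_rQ_eq_of_norm_le P gap gap' E₀ L' hgap hE₀
      (l1_tgt_le_nQ (cellGeomSG_anchor G φ P t _ q δc) (cellGeomSG_a₀ G φ P t _ q δc) h hc)
  · rw [concRadii2S_ρ_eq P gap gap' E₀ L' h1 h2 ℓ, hreal.nS_eq]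
  · rw [concRadii2S_rE_eq P gap gap' E₀ L' h3, hreal.nS_eq]
  · rw [concRadii2S_rM, hreal.nQ_add_stepVec hy]
  · exact nQ_tgt_eq_nS_src_succ (cellGeomSG_anchor G φ P t _ q δc) (cellGeomSG_a₀ G φ P t _ q δc) h hc

end ReachRadii

end Skelφ

end Transplant

end Summit.CriticalPhenomena.PercolationContinuityZ3.Theorems

end
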